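import Summits.Schanuel.Schanuel.Theorems.ZilberEacRealFibreDensity
import HarnessLib

/-!
# Non-split surfaces over a line of REAL IRRATIONAL slope, I: zeros of `P(z; e^z, e^{az+b})` by
# rescaled windows (two-parameter persistence)

HONEST FRAMING.  Cell `pub-schanuel` (Zilber's Exponential-Algebraic Closedness, case ladder;
host summit Schanuel), seat 2, gen 18 (HANDOFF O67 (c)).  Seat 1 (gen 11,
`ZilberEacRealFibre*`) decided Mantova–Masser's density question for the PRODUCT surfaces
`{x₁ = ax₀ + b} × Z(P)`, `a ∈ ℝ ∖ ℚ`, `P ∈ ℂ[y₀, y₁]`, by window periodicity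
`Φ_u(ζ + 2πin) = Φ_{u e^{2πina}}(ζ)` + Kronecker + persistence.  For a NON-SPLIT fibre polynomial
`P ∈ ℂ[x; y₀, y₁]` periodicity fails (the coefficients move with the window), but after division by
`(2πin)^{N₀}` (`N₀` the `x`-degree of `P`) the window-`n` function is a small perturbation of the
product problem for the TOP `x`-ROW `P_{N₀} ∈ ℂ[y₀, y₁]`:
`P(ζ + 2πin; e^ζ, u_n e^{aζ+b}) = ε^{-N₀} Ψ_{(u_n, ε)}(ζ)`, `ε = (2πin)^{-1}`,
`Ψ_{(u,ε)}(ζ) = Σ_k ε^{N₀-k}(1 + εζ)^k P_k(e^ζ, u e^{aζ+b})`, `Ψ_{(u,0)} = Φ^{top}_u`.  This file: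
`exists_zero_near_of_near_param₂` (persistence of zeros for a family parametrised by `ℂ × ℂ`),
`eval_fin3_eq_sum_curveFn` (the row decomposition), **`exists_zero_at_far_window`** (a unimodular
zero `(u₀, x₀)` of `Φ^{top}` produces zeros of `P(z; e^z, e^{az+b})` in far windows with
`e^{2πina} ≈ u₀`), **`exists_lineSurface_zero_tendsto`** and **`exists_lineSurface_accumulation_family`**
(the inputs of the diagonal lemma).  Density: `ZilberEacRealLineSurfaceDensity`.  NOT Schanuel's
conjecture (neither used nor implied; EAC ⇏ SC); `EC(3,2)` stays OPEN; Mantova–Masser's question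
(PLMS 2024, §1 p. 5) stays OPEN in general.
-/

noncomputable section

open Filter Topology Metric Set Complex
open Literature.NumberTheory.Transcendental Literature.ModelTheory.Zilber
open Literature.ModelTheory.ExponentialFields

set_option linter.dupNamespace false

namespace Summit.Schanuel.Schanuel.Theorems

/-! ## Part A. Persistence of zeros, parameters in `ℂ × ℂ` -/

/-- **Zero persistence, two complex parameters** (same proof as `exists_zero_near_of_near_param`).
[folklore] -/
theorem exists_zero_near_of_near_param₂ {Φ : ℂ × ℂ → ℂ → ℂ}
    (hcont : Continuous fun p : (ℂ × ℂ) × ℂ => Φ p.1 p.2) (hdiff : ∀ v, Differentiable ℂ (Φ v))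
    {v₀ : ℂ × ℂ} {x₀ : ℂ} (hne : ∃ z, Φ v₀ z ≠ 0) (hx₀ : Φ v₀ x₀ = 0) {ε : ℝ} (hε : 0 < ε) :
    ∃ δ > 0, ∀ v, ‖v - v₀‖ < δ → ∃ ζ, ‖ζ - x₀‖ < ε ∧ Φ v ζ = 0 := by
  obtain ⟨r, hr0, hrε, m, hm0, hm⟩ := exists_sphere_norm_le (hdiff v₀) hne x₀ hε
  set K : Set ((ℂ × ℂ) × ℂ) := closedBall v₀ 1 ×ˢ sphere x₀ r with hK
  have hKc : IsCompact K := (isCompact_closedBall v₀ 1).prod (isCompact_sphere x₀ r)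
  obtain ⟨δ₁, hδ₁, h₁⟩ := Metric.uniformContinuousOn_iff.1
    (hKc.uniformContinuousOn_of_continuous hcont.continuousOn) (m / 2) (half_pos hm0)
  have hc2 : Continuous fun v => Φ v x₀ := hcont.comp (continuous_id.prodMk continuous_const)
  obtain ⟨δ₂, hδ₂, h₂⟩ := Metric.continuousAt_iff.1 hc2.continuousAt (m / 2) (half_pos hm0)
  refine ⟨min (min δ₁ δ₂) 1, by positivity, fun v hv => ?_⟩
  have hv1 : ‖v - v₀‖ < δ₁ := hv.trans_le ((min_le_left _ _).trans (min_le_left _ _))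
  have hv2 : ‖v - v₀‖ < δ₂ := hv.trans_le ((min_le_left _ _).trans (min_le_right _ _))
  have hv3 : ‖v - v₀‖ < 1 := hv.trans_le (min_le_right _ _)
  have hsphere : ∀ z ∈ sphere x₀ r, m / 2 ≤ ‖Φ v z‖ := by
    intro z hz
    have hzv : (v, z) ∈ K := ⟨mem_closedBall.2 (by rw [dist_eq_norm]; exact hv3.le), hz⟩
    have hzv₀ : (v₀, z) ∈ K := ⟨mem_closedBall_self zero_le_one, hz⟩
    have hd : dist (v, z) (v₀, z) < δ₁ := by
      rw [Prod.dist_eq, dist_self, dist_eq_norm, max_lt_iff]; exact ⟨hv1, hδ₁⟩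
    have h3 := h₁ (v, z) hzv (v₀, z) hzv₀ hd
    rw [dist_eq_norm] at h3
    have h4 := norm_sub_norm_le (Φ v₀ z) (Φ v z)
    rw [norm_sub_rev] at h4
    linarith [hm z hz]
  have hcentre : ‖Φ v x₀‖ < m / 2 := by
    have h3 := h₂ (by rw [dist_eq_norm]; exact hv2)
    rwa [hx₀, dist_zero_right] at h3
  obtain ⟨ζ, hζ, hζ0⟩ := exists_zero_of_norm_lt_of_sphere hr0 (lt_add_one r)
    (hdiff v).differentiableOn hsphere hcentre
  exact ⟨ζ, (by rw [← dist_eq_norm]; exact (mem_ball.1 hζ).trans_le hrε), hζ0⟩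

/-! ## Part B. The row decomposition and the far windows -/

section Windows

variable (a : ℝ) (b : ℂ) (P : MvPolynomial (Fin 3) ℂ)

/-- **Row decomposition**: `P(x; y₀, y₁) = Σ_{k ≤ N₀} x^k P_k(y₀, y₁)` with `P_k` the coefficients
of `P` viewed in `ℂ[y₀, y₁][x]` (`finSuccEquiv`), evaluated at the twisted fibre point. [folklore] -/
theorem eval_fin3_eq_sum_curveFn (u ζ x : ℂ) :
    MvPolynomial.eval (Fin.cons x (rfPt a b u ζ) : Fin 3 → ℂ) P =
      ∑ k ∈ Finset.range ((MvPolynomial.finSuccEquiv ℂ 2 P).natDegree + 1),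
        x ^ k * curveFn a b ((MvPolynomial.finSuccEquiv ℂ 2 P).coeff k) u ζ := by
  rw [MvPolynomial.eval_eq_eval_mv_eval', Polynomial.eval_eq_sum_range'
    (n := (MvPolynomial.finSuccEquiv ℂ 2 P).natDegree + 1)]
  · refine Finset.sum_congr rfl fun k _ => ?_
    rw [Polynomial.coeff_map, curveFn, mul_comm]
  · exact (Polynomial.natDegree_map_le).trans_lt (Nat.lt_succ_self _)

/-- **Zeros in far windows.**  `a ∈ ℝ ∖ ℚ`; `(u₀, x₀)` a zero of the top-row family
`Φ^{top}_u(ζ) = P_{N₀}(e^ζ, u e^{aζ+b})` with `|u₀| = 1` and `Φ^{top}_{u₀} ≢ 0`.  Then for every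
`ε > 0` and `N` there are `n ∈ ℤ`, `|n| ≥ N`, `n ≠ 0`, with `|e^{2πina} - u₀| < ε` and a zero
`z = ζ + 2πin` of `P(z; e^z, e^{az+b})` with `|ζ - x₀| < ε`. (new) -/
theorem exists_zero_at_far_window {a : ℝ} (ha : Irrational a) (b : ℂ) (P : MvPolynomial (Fin 3) ℂ)
    {u₀ x₀ : ℂ} (hu₀ : ‖u₀‖ = 1)
    (hne : ∃ z, curveFn a b (MvPolynomial.finSuccEquiv ℂ 2 P).leadingCoeff u₀ z ≠ 0)
    (hx₀ : curveFn a b (MvPolynomial.finSuccEquiv ℂ 2 P).leadingCoeff u₀ x₀ = 0) {ε : ℝ}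
    (hε : 0 < ε) (N : ℕ) :
    ∃ (n : ℤ) (ζ : ℂ), (N : ℝ) ≤ |(n : ℝ)| ∧ n ≠ 0 ∧ ‖urot (n * a) - u₀‖ < ε ∧ ‖ζ - x₀‖ < ε ∧
      MvPolynomial.eval (Fin.cons (ζ + n * (2 * Real.pi * I)) (rfPt a b 1 (ζ + n * (2 * Real.pi * I))) :
        Fin 3 → ℂ) P = 0 := by
  obtain ⟨Q, hQ⟩ : ∃ Q : Polynomial (MvPolynomial (Fin 2) ℂ), Q = MvPolynomial.finSuccEquiv ℂ 2 P :=
    ⟨_, rfl⟩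
  -- an opaque name for the twisted curve functions (keeps definitional unfolding away)
  obtain ⟨cf, hcf, hcf_cont, hcf_diff⟩ : ∃ cf : MvPolynomial (Fin 2) ℂ → ℂ → ℂ → ℂ,
      cf = curveFn a b ∧ (∀ R, Continuous fun p : ℂ × ℂ => cf R p.1 p.2) ∧
      ∀ R u, Differentiable ℂ (cf R u) :=
    ⟨_, rfl, continuous_curveFn a b, differentiable_curveFn a b⟩
  rw [← hQ, ← hcf] at hne hx₀
  obtain ⟨N₀, hN₀⟩ : ∃ N₀ : ℕ, N₀ = Q.natDegree := ⟨_, rfl⟩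
  -- the rescaled family
  obtain ⟨Ψ, hΨ⟩ : ∃ Ψ : ℂ × ℂ → ℂ → ℂ, ∀ v ζ, Ψ v ζ = ∑ k ∈ Finset.range (N₀ + 1),
      v.2 ^ (N₀ - k) * (1 + v.2 * ζ) ^ k * cf (Q.coeff k) v.1 ζ := ⟨_, fun _ _ => rfl⟩
  have hcont : Continuous fun p : (ℂ × ℂ) × ℂ => Ψ p.1 p.2 := by
    simp only [hΨ]
    refine continuous_finsetSum _ fun k _ => ?_
    have h1 : Continuous fun p : (ℂ × ℂ) × ℂ => p.1.2 := continuous_snd.comp continuous_fst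
    have h2 : Continuous fun p : (ℂ × ℂ) × ℂ => cf (Q.coeff k) p.1.1 p.2 :=
      (hcf_cont (Q.coeff k)).comp ((continuous_fst.comp continuous_fst).prodMk continuous_snd)
    exact ((h1.pow _).mul ((continuous_const.add (h1.mul continuous_snd)).pow _)).mul h2
  have hdiff : ∀ v, Differentiable ℂ (Ψ v) := by
    intro v
    have e : Ψ v = fun ζ => ∑ k ∈ Finset.range (N₀ + 1),
        v.2 ^ (N₀ - k) * (1 + v.2 * ζ) ^ k * cf (Q.coeff k) v.1 ζ := funext (hΨ v)
    rw [e]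
    refine Differentiable.fun_sum fun k _ => ?_
    exact ((differentiable_const _).mul (((differentiable_const _).add
      ((differentiable_const _).mul differentiable_id)).pow _)).mul (hcf_diff (Q.coeff k) v.1)
  -- at `ε = 0` the family is the top-row family
  have hΨ0 : ∀ u ζ, Ψ (u, 0) ζ = cf Q.leadingCoeff u ζ := by
    intro u ζ
    rw [hΨ, Finset.sum_eq_single N₀]
    · rw [Nat.sub_self, pow_zero, one_mul, zero_mul, add_zero, one_pow, one_mul,
        Polynomial.leadingCoeff, ← hN₀]
    · intro k hk hkN
      have hlt : k < N₀ := lt_of_le_of_ne (Nat.lt_succ_iff.1 (Finset.mem_range.1 hk)) hkN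
      rw [zero_pow (Nat.sub_ne_zero_of_lt hlt), zero_mul, zero_mul]
    · intro h; exact absurd (Finset.self_mem_range_succ N₀) h
  have hne' : ∃ z, Ψ (u₀, 0) z ≠ 0 := by obtain ⟨z, hz⟩ := hne; exact ⟨z, by rwa [hΨ0]⟩
  have hx₀' : Ψ (u₀, 0) x₀ = 0 := by rw [hΨ0]; exact hx₀
  obtain ⟨δ, hδ, hzero⟩ := exists_zero_near_of_near_param₂ hcont hdiff hne' hx₀' hε
  -- a far window with `e^{2πina}` near `u₀` and `|1/(2πn)| < δ`
  set N' : ℕ := max (max N 1) (⌈1 / (Real.pi * δ)⌉₊ + 1) with hN'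
  obtain ⟨n, hn, hnu⟩ := exists_urot_near ha hu₀ (lt_min (half_pos hδ) hε) N'
  have hN'le : (N' : ℝ) ≤ |(n : ℝ)| := hn
  have hn1 : (1 : ℝ) ≤ |(n : ℝ)| := le_trans (by exact_mod_cast (le_max_right N 1).trans (le_max_left _ _)) hN'le
  have hn0 : n ≠ 0 := by
    intro h; rw [h] at hn1; norm_num at hn1
  have hnδ : 1 / (Real.pi * δ) < |(n : ℝ)| := by
    have h1 : (1 / (Real.pi * δ) : ℝ) < (⌈1 / (Real.pi * δ)⌉₊ : ℝ) + 1 :=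
      (Nat.le_ceil _).trans_lt (lt_add_one _)
    have h2 : ((⌈1 / (Real.pi * δ)⌉₊ + 1 : ℕ) : ℝ) ≤ N' := by exact_mod_cast le_max_right _ _
    push_cast at h2
    linarith
  set c : ℂ := (n : ℂ) * (2 * Real.pi * I) with hc
  have hcnorm : ‖c‖ = 2 * Real.pi * |(n : ℝ)| := by
    rw [hc, norm_mul, Complex.norm_intCast]
    simp [abs_of_pos Real.pi_pos]; ring
  have hc0 : c ≠ 0 := by
    rw [← norm_pos_iff, hcnorm]; have := Real.pi_pos; positivity
  set εn : ℂ := c⁻¹ with hεn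
  have hεc : εn * c = 1 := inv_mul_cancel₀ hc0
  have hεn_norm : ‖εn‖ < δ / 2 := by
    rw [hεn, norm_inv, hcnorm]
    have hπ := Real.pi_pos
    have hpos : 0 < 2 * Real.pi * |(n : ℝ)| := by positivity
    rw [inv_lt_comm₀ hpos (half_pos hδ)]
    calc (δ / 2)⁻¹ = 2 * Real.pi * (1 / (Real.pi * δ)) := by field_simp
      _ < 2 * Real.pi * |(n : ℝ)| := mul_lt_mul_of_pos_left hnδ (by positivity)
  -- the parameter is `δ`-close
  have hv : ‖((urot (n * a), εn) : ℂ × ℂ) - (u₀, 0)‖ < δ := by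
    rw [Prod.mk_sub_mk, sub_zero, Prod.norm_mk, max_lt_iff]
    exact ⟨hnu.trans_le ((min_le_left _ _).trans (half_le_self hδ.le)), hεn_norm.trans (half_lt_self hδ)⟩
  obtain ⟨ζ, hζ, hΨζ⟩ := hzero _ hv
  refine ⟨n, ζ, le_trans (by exact_mod_cast (le_max_left N 1).trans (le_max_left _ _)) hN'le, hn0,
    hnu.trans_le (min_le_right _ _), hζ, ?_⟩
  -- the window identity `ε^{N₀} P(ζ + c; …) = Ψ_{(u_n, ε)}(ζ)`
  rw [rfPt_add_int_mul, one_mul, eval_fin3_eq_sum_curveFn, ← hQ, ← hN₀, ← hcf]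
  have hid : εn ^ N₀ * (∑ k ∈ Finset.range (N₀ + 1),
      (ζ + c) ^ k * cf (Q.coeff k) (urot (n * a)) ζ) = Ψ (urot (n * a), εn) ζ := by
    rw [hΨ, Finset.mul_sum]
    refine Finset.sum_congr rfl fun k hk => ?_
    have hkN : k ≤ N₀ := Nat.lt_succ_iff.1 (Finset.mem_range.1 hk)
    have e1 : εn ^ N₀ = εn ^ (N₀ - k) * εn ^ k := by rw [← pow_add, Nat.sub_add_cancel hkN]
    have e2 : εn ^ k * (ζ + c) ^ k = (1 + εn * ζ) ^ k := by
      rw [← mul_pow]; congr 1; linear_combination hεc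
    calc εn ^ N₀ * ((ζ + c) ^ k * cf (Q.coeff k) (urot (n * a)) ζ)
        = εn ^ (N₀ - k) * (εn ^ k * (ζ + c) ^ k) * cf (Q.coeff k) (urot (n * a)) ζ := by
          rw [e1]; ring
      _ = εn ^ (N₀ - k) * (1 + εn * ζ) ^ k * cf (Q.coeff k) (urot (n * a)) ζ := by rw [e2]
  have hεN : εn ^ N₀ ≠ 0 := pow_ne_zero _ (inv_ne_zero hc0)
  have := hΨζ
  rw [← hid] at this
  exact (mul_eq_zero.1 this).resolve_left hεN

/-! ## Part C. Accumulation of exponential points at twisted zeros of the top row -/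

/-- **Accumulation at a unimodular zero of the top row.**  Under the hypotheses of
`exists_zero_at_far_window` there are zeros `z_k` of `P(z; e^z, e^{az+b})` with `|z_k| → ∞` whose
fibre points `(e^{z_k}, e^{az_k+b})` converge to `(e^{x₀}, u₀e^{ax₀+b})`. (new) -/
theorem exists_lineSurface_zero_tendsto {a : ℝ} (ha : Irrational a) (b : ℂ)
    (P : MvPolynomial (Fin 3) ℂ) {u₀ x₀ : ℂ} (hu₀ : ‖u₀‖ = 1)
    (hne : ∃ z, curveFn a b (MvPolynomial.finSuccEquiv ℂ 2 P).leadingCoeff u₀ z ≠ 0)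
    (hx₀ : curveFn a b (MvPolynomial.finSuccEquiv ℂ 2 P).leadingCoeff u₀ x₀ = 0) :
    ∃ z : ℕ → ℂ, (∀ k, MvPolynomial.eval (Fin.cons (z k) (rfPt a b 1 (z k)) : Fin 3 → ℂ) P = 0) ∧
      Tendsto (fun k => ‖z k‖) atTop atTop ∧
      Tendsto (fun k => rfPt a b 1 (z k)) atTop (𝓝 (rfPt a b u₀ x₀)) := by
  have key : ∀ k : ℕ, ∃ (n : ℤ) (ζ : ℂ), (k : ℝ) ≤ |(n : ℝ)| ∧
      ‖urot (n * a) - u₀‖ < 1 / ((k : ℝ) + 1) ∧ ‖ζ - x₀‖ < 1 / ((k : ℝ) + 1) ∧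
      MvPolynomial.eval (Fin.cons (ζ + n * (2 * Real.pi * I))
        (rfPt a b 1 (ζ + n * (2 * Real.pi * I))) : Fin 3 → ℂ) P = 0 := by
    intro k
    obtain ⟨n, ζ, hn, -, hnu, hζ, h0⟩ :=
      exists_zero_at_far_window ha b P hu₀ hne hx₀ (Nat.one_div_pos_of_nat (n := k)) k
    exact ⟨n, ζ, hn, hnu, hζ, h0⟩
  choose n ζ hn hnu hζ hzero using key
  have h2π : ‖(2 * Real.pi * I : ℂ)‖ = 2 * Real.pi := by simp [abs_of_pos Real.pi_pos]
  have hU : Tendsto (fun k => urot (n k * a)) atTop (𝓝 u₀) :=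
    tendsto_iff_norm_sub_tendsto_zero.2 (squeeze_zero (fun k => norm_nonneg _)
      (fun k => (hnu k).le) tendsto_one_div_add_atTop_nhds_zero_nat)
  have hZ : Tendsto ζ atTop (𝓝 x₀) :=
    tendsto_iff_norm_sub_tendsto_zero.2 (squeeze_zero (fun k => norm_nonneg _)
      (fun k => (hζ k).le) tendsto_one_div_add_atTop_nhds_zero_nat)
  refine ⟨fun k => ζ k + n k * (2 * Real.pi * I), hzero, ?_, ?_⟩
  · have hlow : ∀ k : ℕ, 2 * Real.pi * (k : ℝ) + -(‖x₀‖ + 1) ≤ ‖ζ k + n k * (2 * Real.pi * I)‖ := by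
      intro k
      have h1 : ‖(n k : ℂ) * (2 * Real.pi * I)‖ = |(n k : ℝ)| * (2 * Real.pi) := by
        rw [norm_mul, Complex.norm_intCast, h2π]
      have h1k : 1 / ((k : ℝ) + 1) ≤ 1 := by
        rw [div_le_one (by positivity)]; linarith [(Nat.cast_nonneg k : (0 : ℝ) ≤ k)]
      have h2 : ‖ζ k‖ ≤ ‖x₀‖ + 1 := by
        have := norm_add_le (ζ k - x₀) x₀
        rw [sub_add_cancel] at this
        linarith [hζ k]
      have h3 : ‖(n k : ℂ) * (2 * Real.pi * I)‖ ≤ ‖ζ k + n k * (2 * Real.pi * I)‖ + ‖ζ k‖ := by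
        have := norm_sub_le (ζ k + n k * (2 * Real.pi * I)) (ζ k)
        rwa [add_sub_cancel_left] at this
      rw [h1] at h3
      have h4 : 2 * Real.pi * (k : ℝ) ≤ |(n k : ℝ)| * (2 * Real.pi) := by
        have := mul_le_mul_of_nonneg_left (hn k) (by positivity : (0 : ℝ) ≤ 2 * Real.pi)
        linarith
      linarith
    have hlim : Tendsto (fun k : ℕ => 2 * Real.pi * (k : ℝ) + -(‖x₀‖ + 1)) atTop atTop :=
      tendsto_atTop_add_const_right _ _
        (Tendsto.const_mul_atTop (by positivity) tendsto_natCast_atTop_atTop)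
    exact tendsto_atTop_mono hlow hlim
  · have e : (fun k => rfPt a b 1 (ζ k + n k * (2 * Real.pi * I))) =
        fun k => rfPt a b (urot (n k * a)) (ζ k) := funext fun k => by
      rw [rfPt_add_int_mul, one_mul]
    rw [e]
    exact ((continuous_rfPt a b).tendsto (u₀, x₀)).comp (hU.prodMk_nhds hZ)

/-- **Accumulation family.**  `a ∈ ℝ ∖ ℚ`; the top row `P_{N₀} ∈ ℂ[y₀, y₁]` of
`P ∈ ℂ[x; y₀, y₁]` has a zero in `(ℂˣ)²`.  Then there are infinitely many pairwise distinct,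
uniformly bounded points `c_i ∈ ℂ²`, each the limit of the fibre points of a sequence of zeros
`z_k` of `P(z; e^z, e^{az+b})` with `|z_k| → ∞`. (new) -/
theorem exists_lineSurface_accumulation_family {a : ℝ} (ha : Irrational a) (b : ℂ)
    (P : MvPolynomial (Fin 3) ℂ)
    (htop : ∃ c : Fin 2 → ℂ, c 0 ≠ 0 ∧ c 1 ≠ 0 ∧
      MvPolynomial.eval c (MvPolynomial.finSuccEquiv ℂ 2 P).leadingCoeff = 0)
    (hP : (MvPolynomial.finSuccEquiv ℂ 2 P).leadingCoeff ≠ 0) :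
    ∃ (c : ℕ → Fin 2 → ℂ) (B : ℝ), Function.Injective c ∧ (∀ i j, ‖c i j‖ ≤ B) ∧
      ∀ i, ∃ z : ℕ → ℂ,
        (∀ k, MvPolynomial.eval (Fin.cons (z k) (rfPt a b 1 (z k)) : Fin 3 → ℂ) P = 0) ∧
        Tendsto (fun k => ‖z k‖) atTop atTop ∧
        Tendsto (fun k => rfPt a b 1 (z k)) atTop (𝓝 (c i)) := by
  set Pt := (MvPolynomial.finSuccEquiv ℂ 2 P).leadingCoeff with hPt
  obtain ⟨u₀, x₀, hu₀, hx₀⟩ := exists_unimodular_zero ha b hP htop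
  have hu₀0 : u₀ ≠ 0 := norm_pos_iff.1 (by rw [hu₀]; exact one_pos)
  obtain ⟨δ, hδ, hzero⟩ := exists_zero_near_of_near_param (continuous_curveFn a b Pt)
    (differentiable_curveFn a b Pt) (exists_curveFn_ne_zero ha b hP hu₀0) hx₀ one_pos
  -- infinitely many rotations `e^{2πi n a}` within `δ` of `1`
  set U : Set ℤ := {n | ‖urot (n * a) - 1‖ < δ} with hU
  have hUinf : U.Infinite := by
    intro hfin
    obtain ⟨M, hM⟩ := (hfin.image fun n : ℤ => |(n : ℝ)|).bddAbove
    obtain ⟨n, hn, hnu⟩ := exists_urot_near ha (u := 1) (by simp) hδ (⌈M⌉₊ + 1)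
    have h1 : |(n : ℝ)| ≤ M := hM ⟨n, hnu, rfl⟩
    have h2 : (M : ℝ) < ⌈M⌉₊ + 1 := (Nat.le_ceil M).trans_lt (lt_add_one _)
    push_cast at hn
    linarith
  set e := hUinf.natEmbedding U with he
  have hui : ∀ i : ℕ, ‖u₀ * urot (((e i : ℤ) : ℝ) * a) - u₀‖ < δ := fun i => by
    rw [← mul_sub_one, norm_mul, hu₀, one_mul]; exact (e i).2
  choose ζ hζ hζ0 using fun i => hzero _ (hui i)
  have hKc : IsCompact
      ((fun p : ℂ × ℂ => rfPt a b p.1 p.2) '' (closedBall u₀ δ ×ˢ closedBall x₀ 1)) :=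
    ((isCompact_closedBall u₀ δ).prod (isCompact_closedBall x₀ 1)).image (continuous_rfPt a b)
  obtain ⟨B, hB⟩ := hKc.isBounded.exists_norm_le
  have hunit : ∀ i : ℕ, ‖u₀ * urot (((e i : ℤ) : ℝ) * a)‖ = 1 := fun i => by
    rw [norm_mul, hu₀, norm_urot, one_mul]
  refine ⟨fun i => rfPt a b (u₀ * urot (((e i : ℤ) : ℝ) * a)) (ζ i), B, ?_, ?_, ?_⟩
  · intro i j hij
    have hzz : ‖ζ i - ζ j‖ < 2 * Real.pi := by
      have h1 := norm_sub_le (ζ i - x₀) (ζ j - x₀)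
      rw [sub_sub_sub_cancel_right] at h1
      linarith [hζ i, hζ j, Real.pi_gt_three]
    have h2 := (rfPt_eq_rfPt_imp hij hzz).2
    have h3 : urot (((e i : ℤ) : ℝ) * a) = urot (((e j : ℤ) : ℝ) * a) := mul_left_cancel₀ hu₀0 h2
    exact e.injective (Subtype.ext (urot_int_mul_injective ha h3))
  · intro i j
    refine (norm_le_pi_norm _ j).trans
      (hB _ ⟨(u₀ * urot (((e i : ℤ) : ℝ) * a), ζ i), ⟨?_, ?_⟩, rfl⟩)
    · exact mem_closedBall.2 (by rw [dist_eq_norm]; exact (hui i).le)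
    · exact mem_closedBall.2 (by rw [dist_eq_norm]; exact (hζ i).le)
  · intro i
    have hne_i : ∃ z, curveFn a b Pt (u₀ * urot (((e i : ℤ) : ℝ) * a)) z ≠ 0 :=
      exists_curveFn_ne_zero ha b hP (norm_pos_iff.1 (by rw [hunit]; exact one_pos))
    exact exists_lineSurface_zero_tendsto ha b P (hunit i) hne_i (hζ0 i)

end Windows

end Summit.Schanuel.Schanuel.Theorems
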